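import Literature.AnabelianGeometry.SemiGraphs.TemperedPiLevelCosetIso
import Literature.AnabelianGeometry.SemiGraphs.GaloisCoveringTorsor
import Literature.AnabelianGeometry.SemiGraphs.TemperedPiLevelsConnected
import Literature.AnabelianGeometry.SemiGraphs.TemperedPiChartExists
import HarnessLib

/-!
# [SemiAnbd] Prop 3.6 p. 38 / Thm 3.7 (iii) p. 41: the finite levels `π₁^temp(𝒢) / ker π_n` are finite
# (T54-B, piece finite-levels-inst)

Mochizuki, *Semi-graphs of anabelioids*, Publ. RIMS **42** (2006), Prop. 3.6 p. 38 ("a cofinal … system of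
connected finite étale Galois coverings `𝒢_i → 𝒢`"; "`Gal(𝒢_{∞,i}/𝒢) → Gal(𝒢_i/𝒢)`") and the proof of
Thm. 3.7 (iii) p. 41 ("Since the semi-graphs `𝔾_j` are all finite") [cite: MochizukiSemiAnbd2006, Prop 3.6 p.38].

PROOF-ONLY (cell row T54-B, producer debt `HOME/plan/GAP-LEDGER.md` G-w4d053-1; node SemiAnbd:Thm5.4).
abc-iut-w4-d053's constructor `ArithLevelDataCpt.ofCosetTower` takes the finite levels `L j` with the
INSTANCE `[∀ j, Finite (c.G ⧸ L j)]`.  At the tempered instantiation `L j := ker π_j`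
(abc-iut-L3-d4's `D.piLevelAut`) this file supplies it:

* `CovObj.finite_aut_of_sameComponent` — `Aut(S)` is finite for `S` connected with a finite fibre
  (`σ ↦ σ(x₀)` is injective by abc-iut-L3-t11's rigidity `CovObj.aut_eq_of_fV_eq`);
* `GaloisLevelData.finite_aut_level` / **`GaloisLevelData.finite_quotient_ker_piLevelAut`** — for a Galois
  tower with finite connected levels, `Gal(𝒢_{S n}) = Aut(S n)` and `π₁^temp(𝒢) / ker π_n ≅ range π_n`
  are finite; `ProfiniteSemiGraph.finite_quotient_ker_piLevelAut_galoisLevelData` — the same for the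
  tower `𝒢.galoisLevelData h36` of Prop. 3.6 (abc-iut-L3-t9: `galoisLevelData_isFinite`,
  `galoisLevelData_hconn`), no hypothesis.

Nothing here refers to the IUT corpus; no side is taken on [IUTchIII] Cor 3.12; typed ≠ proved for Thm 5.4 itself.
-/

namespace Literature.AnabelianGeometry.SemiGraphs

namespace ProfiniteSemiGraph

open CategoryTheory

universe u

variable {𝒢 : ProfiniteSemiGraph.{u}}

/-- **`Aut(S)` is finite** for a connected covering `S` with a finite fibre `S_{v₀} ∋ x₀`: an automorphism
is determined by the image of `x₀`. [cite: MochizukiSemiAnbd2006, Prop 3.6 p.38] -/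
theorem CovObj.finite_aut_of_sameComponent (S : CovObj 𝒢)
    (hconn : ∀ p q : S.Point, S.SameComponent p q) {v₀ : 𝒢.graph.Vertex} (x₀ : (S.SV v₀).obj.V)
    [Finite (S.SV v₀).obj.V] : Finite (Aut S) :=
  Finite.of_injective (fun σ : Aut S => (σ.hom.fV v₀).hom.hom x₀)
    fun _ _ hσ => S.aut_eq_of_fV_eq hconn x₀ hσ

namespace GaloisLevelData

variable (D : GaloisLevelData 𝒢) (h𝒢 : 𝒢.IsCountable)
  (hconn : ∀ (n : ℕ) (p q : (D.S n).Point), (D.S n).SameComponent p q)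

include hconn in
/-- **`Gal(𝒢_{S n}) = Aut(S n)` is finite** for a Galois tower with finite connected levels.
[cite: MochizukiSemiAnbd2006, Prop 3.6 p.38] -/
theorem finite_aut_level (hfin : ∀ n, (D.S n).IsFinite) (n : ℕ) : Finite (Aut (D.S n)) := by
  haveI := (hfin n).finite_V D.v₀
  exact (D.S n).finite_aut_of_sameComponent (hconn n) (D.x n)

/-- **The finite levels of `π₁^temp(𝒢)`**: `π₁^temp(𝒢) / ker π_n ≅ range π_n ≤ Aut(S n)` is finite — the
instance `[∀ j, Finite (c.G ⧸ L j)]` of `ArithLevelDataCpt.ofCosetTower` at `L j := ker (D.piLevelAut j)`.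
[cite: MochizukiSemiAnbd2006, Thm 3.7(iii) p.41] -/
theorem finite_quotient_ker_piLevelAut (hfin : ∀ n, (D.S n).IsFinite) (n : ℕ) :
    Finite (D.temperedPi h𝒢 ⧸ (D.piLevelAut h𝒢 hconn n).ker) := by
  haveI := D.finite_aut_level hconn hfin n
  exact Finite.of_equiv _ (QuotientGroup.quotientKerEquivRange (D.piLevelAut h𝒢 hconn n)).symm.toEquiv

end GaloisLevelData

/-- **The finite levels of `π₁^temp(𝒢)` for the Galois tower of [SemiAnbd] Prop. 3.6** (`𝒢.galoisLevelData h36`: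
connected finite étale Galois coverings): `π₁^temp(𝒢) / ker π_n` is finite, no hypothesis.
[cite: MochizukiSemiAnbd2006, Prop 3.6 p.38] -/
theorem finite_quotient_ker_piLevelAut_galoisLevelData (𝒢 : ProfiniteSemiGraph.{u})
    (h36 : 𝒢.Prop36Hypotheses) (n : ℕ) :
    Finite ((𝒢.galoisLevelData h36).temperedPi h36.isCountable ⧸
      ((𝒢.galoisLevelData h36).piLevelAut h36.isCountable (𝒢.galoisLevelData_hconn h36) n).ker) :=
  (𝒢.galoisLevelData h36).finite_quotient_ker_piLevelAut h36.isCountable (𝒢.galoisLevelData_hconn h36)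
    (𝒢.galoisLevelData_isFinite h36) n

/-- `Aut(S n)` is finite for the levels of the Galois tower of Prop. 3.6. [cite: MochizukiSemiAnbd2006, Prop 3.6 p.38] -/
theorem finite_aut_galoisLevelData (𝒢 : ProfiniteSemiGraph.{u}) (h36 : 𝒢.Prop36Hypotheses) (n : ℕ) :
    Finite (Aut ((𝒢.galoisLevelData h36).S n)) :=
  (𝒢.galoisLevelData h36).finite_aut_level (𝒢.galoisLevelData_hconn h36)
    (𝒢.galoisLevelData_isFinite h36) n

end ProfiniteSemiGraph

end Literature.AnabelianGeometry.SemiGraphs
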